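import Mathlib
import Summits.ValiantsHypothesis.ValiantsHypothesis.Theorems.GrenetZeonTwoDimCoefficientsScalingHessianMassCut
import Summits.ValiantsHypothesis.ValiantsHypothesis.Theorems.GrenetZeonTwoDimCoefficientsScalingSupportGarbage
import Summits.ValiantsHypothesis.ValiantsHypothesis.Theorems.GrenetZeonTwoDimCoefficientsScalingBlockDiagTrace

/-!
# Crux `GrenetZeon.TwoDimCoefficients` (stmt-ValiantsHypothesis-8062) / rung `DualUnipotentThreeHalves` (stmt-24318):
# scaling-closure — BLOCK-TRIANGULAR COUPLING IN HESSIAN CURRENCY (the interface of residual (P3))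

Memo NINETEENTH-HAND.md §10–11 leaves, after the block-DIAGONAL rung (✓ `sq_sub_mul_le_of_blockDiagonal_goodOrGarbage`,
p838515), the residual (P3): a block-TRIANGULAR pencil `N = [[N₀, C], [0, G]]` in the normal form `per_n = tr(N^{n−1}·M)`
(✓ `exists_nilpotent_pencil_of_dualUnipotentRepr`), whose cross terms `Σ_{a+b=n−2} tr(N₀^a·C·G^b·M_{10})` are not covered.
This file turns (P3) into ONE Hessian-rank estimate at ONE explicit point, for any number of levels:

* ★ `rank_sub_mul_le_of_indexParts_add_rankPart` / `…tracePowParts_add_rankPart` — the MASS CUT with a garbage part `g`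
  priced by its Hessian RANK at an arbitrary point `z` (no support hypothesis):
  `per_n = Σ_i κ_i·tr(N_i^{n−1}·M_i) + g`, `N_iⁿ = 0` ⟹ `(rank Hess per_n(z) − rank Hess g(z))·n ≤ 2·Σ_i m_i²`;
  at a permutation point `rank Hess per_n = n²` (✓ p836772), so `(n² − ρ)·n ≤ 2·Σ_i m_i²` (`sq_sub_mul_le_of_tracePowParts_add_rankPart`).
* ★ `trace_pow_mul_eq_sum_classPencil_add_cut` — block-TRIANGULAR bookkeeping: if `N` is level-cut for `lvl`
  (`N i j = 0` whenever `lvl i < lvl j`), then for every `M` and every `k`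
  `tr(N^k·M) = Σ_p tr((N|_p)^k·M|_p) + tr(N^k·M^cut)`, where `M^cut` keeps exactly the entries of `M` at the CUT positions
  (`lvl i < lvl j`) — the positions where `N` itself vanishes; the entries of `M` below the cut are invisible.
* ★★ `sq_sub_mul_le_of_levelCut_goodOrGarbage_cut` — assembly: `per_n = tr(N^{n−1}M)`, `N` level-cut, every class GOOD
  (class pencil of nil-index `≤ n`) or GARBAGE (class pencil supported on the variables of `S`), and the cut term
  `tr(N^{n−1}·M^cut)` of Hessian rank `≤ ρ` at the identity permutation point ⟹ `(n² − 2|S| − ρ)·n ≤ 2·Σ_{p good} s_p²`.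

So the block-triangular coupling costs EXACTLY the Hessian rank of the single polynomial `tr(N^{n−1}·M^cut)` at `P_id`;
(P3) of the census is the estimate `rank Hess_{P_id} tr(N^{n−1}·M^cut) ≤ n²/2` (say) for level-cut pencils with index-`n` classes.

HONEST FRAMING: unconditional bookkeeping and a reduction; no rung beyond p838515 is proved here (with `ρ` unbounded the
inequality is empty): the stub `DualUnipotentBound`, crux 8062, the 24318 decl and `VP ≠ VNP` remain open.

References: T. Mignon, N. Ressayre, Int. Math. Res. Not. 2004:79, Thm. 1.1 (via the tree); folklore.
-/

-- single-conjunct layout `Summits/ValiantsHypothesis/ValiantsHypothesis`: the duplicated namespace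
-- component is mandated by the tree.
set_option linter.dupNamespace false
set_option autoImplicit false

noncomputable section

namespace Summit.ValiantsHypothesis.ValiantsHypothesis.Theorems.GrenetZeonTwoDimCoefficients.ScalingClosure

open MvPolynomial Matrix
open Literature.Computability.AlgebraicComplexity
open Summit.ValiantsHypothesis.ValiantsHypothesis.Cruxes.TwoDimCoefficients.DimTwoCases
open Summit.ValiantsHypothesis.ValiantsHypothesis.Theorems.GrenetZeon.SlowCore

section RankPart

/-- ★ **Mass cut in Hessian currency with a RANK-priced garbage part, at an arbitrary point.**  If
`per_n = Σ_{i<r} κ_i·[tr(adj(1 − N_i)·M_i)]_n + g` with each `N_i` an `m_i × m_i` matrix of linear forms, `N_iⁿ = 0`,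
`N_i^{m_i} = 0`, `M_i` affine, then at every point `z`: `(rank Hess per_n(z) − rank Hess g(z))·n ≤ 2·Σ_i m_i²` (`n ≥ 2`) —
the per-free rates of the constituents (✓ `rank_hess0_top_mul_le_of_index`) add, and `g` costs its own rank.
[cite: MignonRessayre2004, Thm. 1.1 — via the tree; folklore] -/
theorem rank_sub_mul_le_of_indexParts_add_rankPart {n r : ℕ} (hn : 2 ≤ n) (m : Fin r → ℕ)
    (N M : ∀ i : Fin r, AffMat n (m i)) (κ : Fin r → ℂ)
    (hN : ∀ i a b, (N i a b).IsHomogeneous 1) (hM : ∀ i, IsAffine (M i)) (hNn : ∀ i, N i ^ n = 0)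
    (hNm : ∀ i, N i ^ (m i) = 0)
    (g : MvPolynomial (Fin n × Fin n) ℂ) (z : Fin n × Fin n → ℂ)
    (hper : perPoly (Fin n) ℂ =
      (∑ i, MvPolynomial.C (κ i) * homogeneousComponent n (((1 - N i).adjugate * M i).trace)) + g) :
    ((hess0 (transl z (perPoly (Fin n) ℂ))).rank - (hess0 (transl z g)).rank) * n ≤ 2 * ∑ i, m i ^ 2 := by
  classical
  -- each constituent: affine unipotent pencil data and the per-free rate
  have hrate : ∀ i, (hess0 (transl z (homogeneousComponent n (((1 - N i).adjugate * M i).trace)))).rank * n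
      ≤ 2 * m i ^ 2 := by
    intro i
    obtain ⟨c, hc, hdet⟩ := exists_det_one_sub_eq_C (N i) (hNm i)
    have hA : IsAffine (1 - N i) := by
      intro a b
      rw [Matrix.sub_apply]
      refine (totalDegree_sub _ _).trans (max_le ?_ (hN i a b).totalDegree_le)
      rw [Matrix.one_apply]
      split_ifs
      · rw [totalDegree_one]; exact Nat.zero_le _
      · rw [totalDegree_zero]; exact Nat.zero_le _
    have hAN : (1 - N i : AffMat n (m i)) = (1 : Matrix (Fin (m i)) (Fin (m i)) ℂ).map MvPolynomial.C * (1 - N i) := by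
      rw [Matrix.map_one MvPolynomial.C (map_zero _) (map_one _), Matrix.one_mul]
    exact rank_hess0_top_mul_le_of_index hn (1 - N i) (M i) hA (hM i) c hc hdet 1 1 (Matrix.mul_one 1) (N i) (hN i)
      (hNn i) hAN z
  -- additivity of the Hessian and subadditivity of the rank
  have hsplit : hess0 (transl z (perPoly (Fin n) ℂ)) =
      (∑ i, κ i • hess0 (transl z (homogeneousComponent n (((1 - N i).adjugate * M i).trace)))) +
        hess0 (transl z g) := by
    ext s t
    rw [Matrix.add_apply, hess0_transl, hess0_transl, hper, map_add, map_add, map_add, map_sum, map_sum, map_sum,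
      Matrix.sum_apply]
    congr 1
    refine Finset.sum_congr rfl fun i _ => ?_
    rw [Matrix.smul_apply, hess0_transl, smul_eq_mul, pderiv_C_mul, pderiv_C_mul, map_mul, MvPolynomial.eval_C]
  have hsum : (∑ i, κ i • hess0 (transl z (homogeneousComponent n (((1 - N i).adjugate * M i).trace)))).rank
      ≤ ∑ i, (hess0 (transl z (homogeneousComponent n (((1 - N i).adjugate * M i).trace)))).rank :=
    (rank_sum_le _ _).trans (Finset.sum_le_sum fun i _ => rank_smul_le _ _)
  have hle : (hess0 (transl z (perPoly (Fin n) ℂ))).rank ≤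
      (∑ i, (hess0 (transl z (homogeneousComponent n (((1 - N i).adjugate * M i).trace)))).rank)
      + (hess0 (transl z g)).rank := by
    rw [hsplit]
    exact (rank_add_le_rank_add _ _).trans (add_le_add hsum le_rfl)
  have h1 : ((hess0 (transl z (perPoly (Fin n) ℂ))).rank - (hess0 (transl z g)).rank) * n
      ≤ (∑ i, (hess0 (transl z (homogeneousComponent n (((1 - N i).adjugate * M i).trace)))).rank) * n :=
    Nat.mul_le_mul_right _ (by omega)
  refine h1.trans ?_
  rw [Finset.sum_mul, Finset.mul_sum]
  exact Finset.sum_le_sum fun i _ => hrate i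

/-- ★ **Mass cut with a rank-priced garbage part — NORMAL-FORM version, arbitrary point.**  If
`per_n = Σ_{i<r} κ_i·tr(N_i^{n−1}·M_i) + g` with `N_i, M_i` matrices of LINEAR forms of size `m_i`, `N_iⁿ = 0`, `N_i^{m_i} = 0`,
then at every point `z`: `(rank Hess per_n(z) − rank Hess g(z))·n ≤ 2·Σ_i m_i²` (`n ≥ 2`).
[cite: MignonRessayre2004, Thm. 1.1 — via the tree; folklore] -/
theorem rank_sub_mul_le_of_tracePowParts_add_rankPart {n r : ℕ} (hn : 2 ≤ n) (m : Fin r → ℕ)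
    (N M : ∀ i : Fin r, AffMat n (m i)) (κ : Fin r → ℂ)
    (hN : ∀ i a b, (N i a b).IsHomogeneous 1) (hM : ∀ i a b, (M i a b).IsHomogeneous 1) (hNn : ∀ i, N i ^ n = 0)
    (hNm : ∀ i, N i ^ (m i) = 0)
    (g : MvPolynomial (Fin n × Fin n) ℂ) (z : Fin n × Fin n → ℂ)
    (hper : perPoly (Fin n) ℂ = (∑ i, MvPolynomial.C (κ i) * (N i ^ (n - 1) * M i).trace) + g) :
    ((hess0 (transl z (perPoly (Fin n) ℂ))).rank - (hess0 (transl z g)).rank) * n ≤ 2 * ∑ i, m i ^ 2 := by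
  classical
  -- constants `c_i = det(1 − N_i)` and the rescaled coefficients
  have hc : ∀ i, ∃ c : ℂ, c ≠ 0 ∧ (1 - N i).det = MvPolynomial.C c := fun i => exists_det_one_sub_eq_C (N i) (hNm i)
  choose c hc0 hcdet using hc
  refine rank_sub_mul_le_of_indexParts_add_rankPart hn m N M (fun i => κ i * (c i)⁻¹) hN
    (fun i a b => (hM i a b).totalDegree_le) hNn hNm g z ?_
  rw [hper]
  congr 1
  refine Finset.sum_congr rfl fun i _ => ?_
  rw [homogeneousComponent_trace_adjugate_one_sub_mul (by omega) (N i) (M i) (hN i) (hM i) (hNn i) (hc0 i) (hcdet i),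
    ← mul_assoc, ← map_mul, mul_assoc, inv_mul_cancel₀ (hc0 i), mul_one]

/-- ★ **Mass cut with a rank-priced garbage part at a PERMUTATION POINT.**  If
`per_n = Σ_{i<r} κ_i·tr(N_i^{n−1}·M_i) + g` (`N_i, M_i` linear of size `m_i`, `N_iⁿ = 0`, `N_i^{m_i} = 0`) and
`rank Hess g (P_τ) ≤ ρ` at the permutation point `P_τ`, then `(n² − ρ)·n ≤ 2·Σ_i m_i²` (`n ≥ 2`; ✓ `rank Hess per_n(P_τ) = n²`).
With `ρ = 2|S|` for `g` linear off `S` this is ✓ `sq_sub_mul_le_of_tracePowParts_add_supportPart`.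
[cite: MignonRessayre2004, Thm. 1.1 — via the tree; folklore] -/
theorem sq_sub_mul_le_of_tracePowParts_add_rankPart {n r : ℕ} (hn : 2 ≤ n) (m : Fin r → ℕ)
    (N M : ∀ i : Fin r, AffMat n (m i)) (κ : Fin r → ℂ)
    (hN : ∀ i a b, (N i a b).IsHomogeneous 1) (hM : ∀ i a b, (M i a b).IsHomogeneous 1) (hNn : ∀ i, N i ^ n = 0)
    (hNm : ∀ i, N i ^ (m i) = 0)
    (g : MvPolynomial (Fin n × Fin n) ℂ) (τ : Equiv.Perm (Fin n)) (ρ : ℕ)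
    (hg : (hess0 (transl (fun u : Fin n × Fin n => if u.1 = τ u.2 then (1 : ℂ) else 0) g)).rank ≤ ρ)
    (hper : perPoly (Fin n) ℂ = (∑ i, MvPolynomial.C (κ i) * (N i ^ (n - 1) * M i).trace) + g) :
    (n ^ 2 - ρ) * n ≤ 2 * ∑ i, m i ^ 2 := by
  have h := rank_sub_mul_le_of_tracePowParts_add_rankPart hn m N M κ hN hM hNn hNm g
    (fun u : Fin n × Fin n => if u.1 = τ u.2 then (1 : ℂ) else 0) hper
  rw [rank_hess0_transl_permPoint_perPoly hn τ] at h
  exact (Nat.mul_le_mul_right _ (by omega)).trans h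

end RankPart

section LevelCutTrace

variable {n m : ℕ}

/-- ★ **Block-TRIANGULAR bookkeeping.**  For a level-cut pencil `N` (`N i j = 0` whenever `lvl i < lvl j`; class
equivalences `e p`), every `M` and every `k`:
`tr(N^k·M) = Σ_{p ∈ lvl(univ)} tr((classPencil N (e p))^k · classPencil M (e p)) + tr(N^k · M^cut)`, where
`M^cut i j = M i j` if `lvl i < lvl j` and `0` otherwise — the cut term sees exactly the entries of `M` at the positions where
`N` is cut to zero; the entries of `M` strictly below the cut never contribute. (Block-diagonal `N`: ✓ `trace_pow_mul_eq_sum_classPencil`.)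
[folklore] -/
theorem trace_pow_mul_eq_sum_classPencil_add_cut (lvl : Fin m → ℕ) (N M : AffMat n m)
    (hcut : ∀ a b, lvl a < lvl b → N a b = 0) (s : ℕ → ℕ)
    (e : ∀ p : ℕ, {i : Fin m // lvl i = p} ≃ Fin (s p)) (k : ℕ) :
    (N ^ k * M).trace = (∑ p ∈ Finset.univ.image lvl, ((classPencil N (e p)) ^ k * classPencil M (e p)).trace)
      + (N ^ k * Matrix.of (fun i j : Fin m => if lvl i < lvl j then M i j else 0)).trace := by
  classical
  set Mc : AffMat n m := Matrix.of (fun i j : Fin m => if lvl i < lvl j then M i j else 0) with hMc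
  -- pointwise split of the inner sum of `tr(N^k·M) = Σ_a Σ_b (N^k)_{ab} M_{ba}`
  have hinner : ∀ a, ∑ b, (N ^ k) a b * M b a =
      (∑ b ∈ Finset.univ.filter (fun b => lvl b = lvl a), (N ^ k) a b * M b a) + ∑ b, (N ^ k) a b * Mc b a := by
    intro a
    rw [← Finset.sum_filter_add_sum_filter_not Finset.univ (fun b => lvl b = lvl a) (fun b => (N ^ k) a b * M b a)]
    congr 1
    rw [← Finset.sum_filter_add_sum_filter_not Finset.univ (fun b => lvl b = lvl a) (fun b => (N ^ k) a b * Mc b a)]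
    have hzero : ∑ b ∈ Finset.univ.filter (fun b => lvl b = lvl a), (N ^ k) a b * Mc b a = 0 := by
      refine Finset.sum_eq_zero fun b hb => ?_
      rw [Finset.mem_filter] at hb
      rw [hMc, Matrix.of_apply, if_neg (by rw [hb.2]; exact lt_irrefl _), mul_zero]
    rw [hzero, zero_add]
    refine Finset.sum_congr rfl fun b hb => ?_
    rw [Finset.mem_filter] at hb
    rcases lt_or_gt_of_ne hb.2 with hlt | hgt
    · -- `lvl b < lvl a`: a cut entry of `M`
      rw [hMc, Matrix.of_apply, if_pos hlt]
    · -- `lvl a < lvl b`: the power does not climb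
      rw [pow_apply_eq_zero_of_lvl_lt lvl N hcut k a b hgt, zero_mul, zero_mul]
  -- the class part, level by level, re-indexed by `Fin (s p)`
  have hclass : ∀ p, (∑ a ∈ Finset.univ.filter (fun a => lvl a = p),
      ∑ b ∈ Finset.univ.filter (fun b => lvl b = lvl a), (N ^ k) a b * M b a) =
      ((classPencil N (e p)) ^ k * classPencil M (e p)).trace := by
    intro p
    rw [Finset.sum_subtype (Finset.univ.filter (fun a => lvl a = p)) (p := fun a => lvl a = p) (by simp)]
    rw [← Fintype.sum_equiv (e p).symm
      (fun a' => ∑ b ∈ Finset.univ.filter (fun b => lvl b = lvl (classEmb (e p) a')),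
        (N ^ k) (classEmb (e p) a') b * M b (classEmb (e p) a'))
      (fun x => ∑ b ∈ Finset.univ.filter (fun b => lvl b = lvl (x : Fin m)), (N ^ k) (x : Fin m) b * M b (x : Fin m))
      (fun a' => rfl)]
    rw [Matrix.trace]
    refine Finset.sum_congr rfl fun a' _ => ?_
    rw [Matrix.diag_apply, Matrix.mul_apply, lvl_classEmb (e p) a']
    rw [Finset.sum_subtype (Finset.univ.filter (fun b => lvl b = p)) (p := fun b => lvl b = p) (by simp),
      ← Fintype.sum_equiv (e p).symm
        (fun c' => (N ^ k) (classEmb (e p) a') (classEmb (e p) c') * M (classEmb (e p) c') (classEmb (e p) a'))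
        (fun x => (N ^ k) (classEmb (e p) a') (x : Fin m) * M (x : Fin m) (classEmb (e p) a')) (fun c' => rfl)]
    refine Finset.sum_congr rfl fun c' _ => ?_
    rw [classPencil, submatrix_pow_apply_of_levelCut N hcut (e p) k a' c', classPencil, Matrix.submatrix_apply]
  -- assemble
  have htr : (N ^ k * M).trace = ∑ a, ∑ b, (N ^ k) a b * M b a := by
    simp only [Matrix.trace, Matrix.diag_apply, Matrix.mul_apply]
  have htrc : (N ^ k * Mc).trace = ∑ a, ∑ b, (N ^ k) a b * Mc b a := by
    simp only [Matrix.trace, Matrix.diag_apply, Matrix.mul_apply]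
  rw [htr, htrc, Finset.sum_congr rfl (fun a _ => hinner a), Finset.sum_add_distrib]
  congr 1
  rw [← Finset.sum_fiberwise_of_maps_to (g := lvl) (t := Finset.univ.image lvl)
    (fun a ha => Finset.mem_image_of_mem lvl ha)]
  exact Finset.sum_congr rfl fun p _ => hclass p

/-- The cut part of a matrix of linear forms is a matrix of linear forms. [folklore] -/
theorem isHomogeneous_cut (lvl : Fin m → ℕ) (M : AffMat n m) (hM : ∀ i j, (M i j).IsHomogeneous 1) (i j : Fin m) :
    (Matrix.of (fun i j : Fin m => if lvl i < lvl j then M i j else 0) i j).IsHomogeneous 1 := by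
  rw [Matrix.of_apply]
  split_ifs
  · exact hM i j
  · exact isHomogeneous_zero _ _ _

end LevelCutTrace

section LevelCutRung

variable {n m : ℕ}

/-- ★★ **The 3/2 rung for block-TRIANGULAR pencils, up to the Hessian rank of the cut term.**  Normal form
`per_n = tr(N^{n−1}M)` with `N, M` linear, `N` level-cut for `lvl` (`N i j = 0` whenever `lvl i < lvl j`); classes in
`good` have class pencils of nil-index `≤ n`, the other classes have class pencils involving only the variables of `S`;
and the CUT TERM `tr(N^{n−1}·M^cut)` has Hessian rank `≤ ρ` at the identity permutation point.  Then
`(n² − 2|S| − ρ)·n ≤ 2·Σ_{p ∈ good} s_p²` (`n ≥ 2`).  (Block-diagonal `N`: the cut term vanishes, `ρ = 0`: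
✓ `sq_sub_mul_le_of_blockDiagonal_goodOrGarbage`.) [cite: MignonRessayre2004, Thm. 1.1 — via the tree; folklore] -/
theorem sq_sub_mul_le_of_levelCut_goodOrGarbage_cut (hn : 2 ≤ n) (N M : AffMat n m)
    (hN : ∀ i j, (N i j).IsHomogeneous 1) (hM : ∀ i j, (M i j).IsHomogeneous 1)
    (hper : perPoly (Fin n) ℂ = (N ^ (n - 1) * M).trace)
    (lvl : Fin m → ℕ) (hcut : ∀ a b, lvl a < lvl b → N a b = 0)
    (s : ℕ → ℕ) (e : ∀ p : ℕ, {i : Fin m // lvl i = p} ≃ Fin (s p))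
    (good : Finset ℕ) (hgoodsub : good ⊆ Finset.univ.image lvl)
    (hgood : ∀ p ∈ good, (classPencil N (e p)) ^ n = 0)
    (S : Finset (Fin n × Fin n))
    (hbad : ∀ p ∈ Finset.univ.image lvl, p ∉ good → ∀ a b, ∀ c ∉ S, pderiv c (classPencil N (e p) a b) = 0)
    (ρ : ℕ)
    (hρ : (hess0 (transl (fun u : Fin n × Fin n => if u.1 = (1 : Equiv.Perm (Fin n)) u.2 then (1 : ℂ) else 0)
      ((N ^ (n - 1) * Matrix.of (fun i j : Fin m => if lvl i < lvl j then M i j else 0)).trace))).rank ≤ ρ) :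
    (n ^ 2 - 2 * S.card - ρ) * n ≤ 2 * ∑ p ∈ good, s p ^ 2 := by
  classical
  set z : Fin n × Fin n → ℂ := fun u => if u.1 = (1 : Equiv.Perm (Fin n)) u.2 then (1 : ℂ) else 0 with hz
  set cutTerm : MvPolynomial (Fin n × Fin n) ℂ :=
    (N ^ (n - 1) * Matrix.of (fun i j : Fin m => if lvl i < lvl j then M i j else 0)).trace with hcutTerm
  -- the decomposition into constituents plus the cut term
  have hsplit := trace_pow_mul_eq_sum_classPencil_add_cut lvl N M hcut s e (n - 1)
  set levels := Finset.univ.image lvl with hlev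
  set gS : MvPolynomial (Fin n × Fin n) ℂ :=
    ∑ p ∈ levels.filter (fun p => p ∉ good), ((classPencil N (e p)) ^ (n - 1) * classPencil M (e p)).trace with hgS
  have hgood_eq : levels.filter (fun p => p ∈ good) = good := by
    ext p
    rw [Finset.mem_filter]
    exact ⟨fun h => h.2, fun h => ⟨hgoodsub h, h⟩⟩
  have hper' : perPoly (Fin n) ℂ =
      (∑ p ∈ good, ((classPencil N (e p)) ^ (n - 1) * classPencil M (e p)).trace) + (gS + cutTerm) := by
    rw [hper, hsplit, ← hgood_eq, hgS, ← add_assoc]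
    congr 1
    exact (Finset.sum_filter_add_sum_filter_not levels (fun p => p ∈ good) _).symm
  -- the support garbage is linear off `S`
  have hgSS : ∀ c c', c ∉ S → c' ∉ S → pderiv c (pderiv c' gS) = 0 := by
    intro c c' hc hc'
    rw [hgS, map_sum, map_sum]
    refine Finset.sum_eq_zero fun p hp => ?_
    rw [Finset.mem_filter] at hp
    exact pderiv_pderiv_trace_pow_mul_eq_zero _ _ S (hbad p hp.1 hp.2)
      (isAffine_classPencil M (fun i j => (hM i j).totalDegree_le) (e p)) (n - 1) c c' hc hc'
  -- the garbage `gS + cutTerm` costs `2|S| + ρ` at the identity point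
  have hrank : (hess0 (transl z (gS + cutTerm))).rank ≤ 2 * S.card + ρ := by
    rw [map_add, map_add]
    exact (rank_add_le_rank_add _ _).trans
      (add_le_add (rank_hess0_transl_le_of_pderiv_pderiv_eq_zero gS S hgSS z) hρ)
  -- re-index the good classes by `Fin r`
  set r := good.card with hr
  set enum : Fin r → ℕ := fun i => (good.equivFin.symm i : ℕ) with henum
  have henum_mem : ∀ i, enum i ∈ good := fun i => (good.equivFin.symm i).2
  have hsum_enum : ∀ f : ℕ → MvPolynomial (Fin n × Fin n) ℂ, ∑ p ∈ good, f p = ∑ i : Fin r, f (enum i) := by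
    intro f
    rw [← Finset.sum_coe_sort good]
    exact (Fintype.sum_equiv good.equivFin.symm (fun i => f (enum i)) (fun x => f x) (fun i => rfl)).symm
  have hsum_enum_nat : ∑ p ∈ good, s p ^ 2 = ∑ i : Fin r, s (enum i) ^ 2 := by
    rw [← Finset.sum_coe_sort good]
    exact (Fintype.sum_equiv good.equivFin.symm (fun i => s (enum i) ^ 2) (fun x => s x ^ 2) (fun i => rfl)).symm
  rw [hsum_enum_nat]
  have hmain := sq_sub_mul_le_of_tracePowParts_add_rankPart hn (fun i => s (enum i))
    (fun i => classPencil N (e (enum i))) (fun i => classPencil M (e (enum i))) (fun _ => 1)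
    (fun i a b => hN _ _) (fun i a b => hM _ _) (fun i => hgood _ (henum_mem i))
    (fun i => pow_card_eq_zero_of_pow_eq_zero _ (hgood _ (henum_mem i))) (gS + cutTerm) 1 (2 * S.card + ρ) hrank
    (by rw [hper', hsum_enum]; simp only [map_one, one_mul])
  have hρ' : n ^ 2 - 2 * S.card - ρ = n ^ 2 - (2 * S.card + ρ) := by omega
  rw [hρ']
  exact hmain

end LevelCutRung

section LevelCutLedger

variable {n m : ℕ}

/-- **The constraints descend to the cut term.**  For a level-cut pencil `N`, every vanishing trace `tr(N^k·M) = 0` is an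
identity between the cut term and the class terms: `tr(N^k·M^cut) = −Σ_p tr((N|_p)^k·M|_p)`. [folklore] -/
theorem trace_pow_mul_cut_eq_neg_sum_classPencil (lvl : Fin m → ℕ) (N M : AffMat n m)
    (hcut : ∀ a b, lvl a < lvl b → N a b = 0) (s : ℕ → ℕ)
    (e : ∀ p : ℕ, {i : Fin m // lvl i = p} ≃ Fin (s p)) (k : ℕ) (hk : (N ^ k * M).trace = 0) :
    (N ^ k * Matrix.of (fun i j : Fin m => if lvl i < lvl j then M i j else 0)).trace =
      -∑ p ∈ Finset.univ.image lvl, ((classPencil N (e p)) ^ k * classPencil M (e p)).trace := by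
  rw [trace_pow_mul_eq_sum_classPencil_add_cut lvl N M hcut s e k] at hk
  exact eq_neg_of_add_eq_zero_right hk

/-- ★ **High constraints of the cut term.**  If `N` is level-cut, every class pencil has nil-index `≤ n`, and the
representation constraint `tr(N^k·M) = 0` holds for some `k ≥ n`, then the cut term has the same vanishing companion:
`tr(N^k·M^cut) = 0`.  (In the normal form of ✓ `exists_constrained_pencil_of_dualUnipotentRepr` the constraints hold for
every `k ≠ n − 1`; so the cut term of a level-cut representation with index-`n` classes satisfies `tr(N^k·M^cut) = 0` for ALL
`k ≥ n` — the input any pricing of the block-triangular coupling (P3) must use.) [folklore] -/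
theorem trace_pow_mul_cut_eq_zero_of_classIndex (lvl : Fin m → ℕ) (N M : AffMat n m)
    (hcut : ∀ a b, lvl a < lvl b → N a b = 0) (s : ℕ → ℕ)
    (e : ∀ p : ℕ, {i : Fin m // lvl i = p} ≃ Fin (s p))
    (hindex : ∀ p ∈ Finset.univ.image lvl, (classPencil N (e p)) ^ n = 0)
    (k : ℕ) (hk : n ≤ k) (hzero : (N ^ k * M).trace = 0) :
    (N ^ k * Matrix.of (fun i j : Fin m => if lvl i < lvl j then M i j else 0)).trace = 0 := by
  rw [trace_pow_mul_cut_eq_neg_sum_classPencil lvl N M hcut s e k hzero, neg_eq_zero]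
  refine Finset.sum_eq_zero fun p hp => ?_
  obtain ⟨j, rfl⟩ : ∃ j, k = n + j := ⟨k - n, by omega⟩
  rw [pow_add, hindex p hp, zero_mul, zero_mul, Matrix.trace_zero]

/-- ★★ **The ledger inequality of a level-cut representation.**  Normal form `per_n = tr(N^{n−1}M)` (`N, M` linear), `N`
level-cut for `lvl`, `good` a set of levels whose class pencils have nil-index `≤ n`.  Let
`rest := Σ_{p ∉ good} tr((N|_p)^{n−1}·M|_p) + tr(N^{n−1}·M^cut)` (the remaining classes — wild, triangular of large index,
garbage — and the cut term).  Then `(n² − rank Hess rest (P_id))·n ≤ 2·Σ_{p ∈ good} s_p²` (`n ≥ 2`): every constituent not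
priced by the index-`n` rate law is priced by its Hessian rank at ONE point, and nothing else enters.
(✓ `sq_sub_mul_le_of_levelCut_goodOrGarbage_cut` is the case where the remaining classes are support garbage.)
[cite: MignonRessayre2004, Thm. 1.1 — via the tree; folklore] -/
theorem sq_sub_rank_mul_le_of_levelCut (hn : 2 ≤ n) (N M : AffMat n m)
    (hN : ∀ i j, (N i j).IsHomogeneous 1) (hM : ∀ i j, (M i j).IsHomogeneous 1)
    (hper : perPoly (Fin n) ℂ = (N ^ (n - 1) * M).trace)
    (lvl : Fin m → ℕ) (hcut : ∀ a b, lvl a < lvl b → N a b = 0)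
    (s : ℕ → ℕ) (e : ∀ p : ℕ, {i : Fin m // lvl i = p} ≃ Fin (s p))
    (good : Finset ℕ) (hgoodsub : good ⊆ Finset.univ.image lvl)
    (hgood : ∀ p ∈ good, (classPencil N (e p)) ^ n = 0) :
    (n ^ 2 - (hess0 (transl (fun u : Fin n × Fin n => if u.1 = (1 : Equiv.Perm (Fin n)) u.2 then (1 : ℂ) else 0)
        ((∑ p ∈ (Finset.univ.image lvl).filter (fun p => p ∉ good),
            ((classPencil N (e p)) ^ (n - 1) * classPencil M (e p)).trace) +
          (N ^ (n - 1) * Matrix.of (fun i j : Fin m => if lvl i < lvl j then M i j else 0)).trace))).rank) * n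
      ≤ 2 * ∑ p ∈ good, s p ^ 2 := by
  classical
  set z : Fin n × Fin n → ℂ := fun u => if u.1 = (1 : Equiv.Perm (Fin n)) u.2 then (1 : ℂ) else 0 with hz
  set cutTerm : MvPolynomial (Fin n × Fin n) ℂ :=
    (N ^ (n - 1) * Matrix.of (fun i j : Fin m => if lvl i < lvl j then M i j else 0)).trace with hcutTerm
  have hsplit := trace_pow_mul_eq_sum_classPencil_add_cut lvl N M hcut s e (n - 1)
  set levels := Finset.univ.image lvl with hlev
  set gW : MvPolynomial (Fin n × Fin n) ℂ :=
    ∑ p ∈ levels.filter (fun p => p ∉ good), ((classPencil N (e p)) ^ (n - 1) * classPencil M (e p)).trace with hgW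
  have hgood_eq : levels.filter (fun p => p ∈ good) = good := by
    ext p
    rw [Finset.mem_filter]
    exact ⟨fun h => h.2, fun h => ⟨hgoodsub h, h⟩⟩
  have hper' : perPoly (Fin n) ℂ =
      (∑ p ∈ good, ((classPencil N (e p)) ^ (n - 1) * classPencil M (e p)).trace) + (gW + cutTerm) := by
    rw [hper, hsplit, ← hgood_eq, hgW, ← add_assoc]
    congr 1
    exact (Finset.sum_filter_add_sum_filter_not levels (fun p => p ∈ good) _).symm
  -- re-index the good classes by `Fin r`
  set r := good.card with hr
  set enum : Fin r → ℕ := fun i => (good.equivFin.symm i : ℕ) with henum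
  have henum_mem : ∀ i, enum i ∈ good := fun i => (good.equivFin.symm i).2
  have hsum_enum : ∀ f : ℕ → MvPolynomial (Fin n × Fin n) ℂ, ∑ p ∈ good, f p = ∑ i : Fin r, f (enum i) := by
    intro f
    rw [← Finset.sum_coe_sort good]
    exact (Fintype.sum_equiv good.equivFin.symm (fun i => f (enum i)) (fun x => f x) (fun i => rfl)).symm
  have hsum_enum_nat : ∑ p ∈ good, s p ^ 2 = ∑ i : Fin r, s (enum i) ^ 2 := by
    rw [← Finset.sum_coe_sort good]
    exact (Fintype.sum_equiv good.equivFin.symm (fun i => s (enum i) ^ 2) (fun x => s x ^ 2) (fun i => rfl)).symm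
  rw [hsum_enum_nat]
  exact sq_sub_mul_le_of_tracePowParts_add_rankPart hn (fun i => s (enum i))
    (fun i => classPencil N (e (enum i))) (fun i => classPencil M (e (enum i))) (fun _ => 1)
    (fun i a b => hN _ _) (fun i a b => hM _ _) (fun i => hgood _ (henum_mem i))
    (fun i => pow_card_eq_zero_of_pow_eq_zero _ (hgood _ (henum_mem i))) (gW + cutTerm) 1 _ le_rfl
    (by rw [hper', hsum_enum]; simp only [map_one, one_mul])

end LevelCutLedger

end Summit.ValiantsHypothesis.ValiantsHypothesis.Theorems.GrenetZeonTwoDimCoefficients.ScalingClosure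

end
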